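import Literature.Probability.LatticeModels.ImprovedTreeDiagramBound
import Literature.Probability.LatticeModels.TwoPointSupNormMonotone
import Literature.Probability.LatticeModels.PlusFreeComparison
import Literature.Probability.LatticeModels.CriticalGibbsUniqueness
import HarnessLib

/-!
# Growth of the bubble diagram (Aizenman–Duminil-Copin 2021, Lemma 6.3): the proof

Topic `Literature/Probability/LatticeModels`; family `crit-ising`. Proof companion of
`ImprovedTreeDiagramBound`: it reduces the named fact
`aizenmanDuminilCopin_bubbleDiagram_growth` (M. Aizenman, H. Duminil-Copin, *Marginal triviality
of the scaling limits of critical 4D Ising and `φ⁴₄` models*, Ann. of Math. **194** (2021) =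
arXiv:1912.07973, **Lemma 6.3**, p. 21, in the proof-supported form vendored there) to the single
named fact `aizenmanDuminilCopin_slidingScaleInfraredBound` (ibid., **Theorem 5.6**, the
sliding-scale infrared bound), every other input of the printed proof being a theorem of the tree:

* `aizenmanDuminilCopin_bubbleDiagram_growth_of_slidingScaleInfraredBound` — Lemma 6.3 from
  Theorem 5.6.

## The printed proof (arXiv:1912.07973, p. 21) and its formalisation

For a dyadic `N ≥ ℓ` and a scale `n = 2^k ≤ ℓ` which is *regular* for Property P4 of Def. 5.11
(`χ_{2n} ≥ (1+c) χ_n`; only P4 is used by the printed proof), display (6.3) reads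
`B_{2N} - B_N ≤ C₀ N⁻⁴ χ_{N/d}² ≤ C₁ n⁻⁴ χ_n² ≤ C₂ n⁻⁴ (χ_{2n} - χ_n)² ≤ C₃ (B_{2n} - B_n)` by,
in turn, the Messager–Miracle-Solé comparison (5.3) (`twoPointPlus_le_of_mul_supNorm_le`,
`TwoPointSupNormMonotone`), the sliding-scale infrared bound (Thm 5.6, the hypothesis), P4, and
Cauchy–Schwarz (`bubbleDiagram_shell_le`, `sq_boxSusceptibility_div_le_of_regular`). "There
are `log₂(L/ℓ)` scales between `ℓ` and `L`" (`dyadic_cover`) "and at least `c log₂ ℓ` regular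
scales between `1` and `ℓ`" — the P4 part of Thm 5.12 (abundance of regular scales), whose
printed proof (p. 20) is a pigeonhole on the dyadic growth of `χ`: `χ_{2^K} ≥ c 2^K` (from the
lower bound on the sphere sums, the mechanism of Cor. 5.8), `χ_1 ≤ 81`, and each doubling ratio
is at most `4C/β` by Thm 5.6 (`boxSusceptibility_two_pow_le`, `card_regular_ge`); "since the
sums of squared correlations on any of the former contribute less to `B_L - B_ℓ` than any of the
latter to `B_ℓ`" (`card_mul_shell_le`), the bound follows (`bubbleDiagram_growth_abstract`, the
abstract form of Lemma 6.3 for a function `S : ℤ⁴ → [0,1]` with the listed properties, with a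
constant depending only on `K = max(C/β₀, 1)` and on the sphere-sum lower bound `θ`).

The model inputs (Part 3–4): for `μ ∈ 𝒢(β, 0)`, `0 < β ≤ β_c(4)`, the two-point function
`⟨σ₀σ_x⟩_μ` is the plus/free two-point function (`twoPoint_eq_twoPointPlus_of_isingGibbsMeasure`:
uniqueness below and at `β_c`, `CriticalGibbsUniqueness`, and Lebowitz–Martin-Löf,
`PlusFreeComparison`); in the window `L ≤ ξ(β)` — `L ξ(β)⁻¹ ≤ 1` with
`ξ⁻¹ = liminf -log⟨σ₀σ_{Me₁}⟩⁺/M` — the iterated boundary inequality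
`⟨σ₀σ_z⟩⁺ ≤ ψ_β(Λ_n)^k` (`‖z‖_∞ > k(n+2)`, `CriticalTwoPointLower`) gives `ψ_β(Λ_n) ≥ e^{-(n+2)/L}`
(`exp_le_bdryPsi_of_invCorrLength`; at `β_c`, `ψ ≥ 1`), whence `β ≥ e^{-2}/2592`
(`beta_ge_of_window`, making `C/β` uniform) and `∑_{∂Λ_n} ⟨σ₀σ_y⟩⁺ ≥ e^{-2}/(32 β_c)` for `n ≤ L`
(`sphereSum_ge_of_window`); GKS II along the axis (`pow_le_twoPointPlus_single`) keeps the
`liminf` finite. The degenerate alternative `⟨σ₀σ_{e₁}⟩⁺ = 0` (which cannot occur for `β > 0`, but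
is cheaper to dispose of than to exclude) forces `⟨σ₀σ_y⟩⁺ = 0` for `y ≠ 0`
(`twoPointPlus_eq_zero_of_axis_eq_zero`), so that `B_L = B_ℓ = 1`.

## What remains for `aizenmanDuminilCopin_bubbleDiagram_growth_holds`

Exactly the named fact `aizenmanDuminilCopin_slidingScaleInfraredBound` (ADC Thm 5.6: spectral
representation of the transfer matrix and a Fourier argument), used twice as in print (the
transfer from scale `N/4` to a regular scale `n`, and the doubling bound in the pigeonhole).

## Mathlib

`Filter.liminf`, `Filter.le_liminf_of_le`, `Filter.isCoboundedUnder_ge_of_eventually_le`,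
`Finset.sum_mul_sq_le_sq_mul_sq` (Cauchy–Schwarz), `Finset.sum_range_sub` (telescoping),
`Nat.log`, `Real.log`, `symmDiff` of finsets. No Ising model in Mathlib.
-/

noncomputable section

open MeasureTheory Finset Filter Topology
open scoped symmDiff

namespace Literature.Probability.LatticeModels

/-! ### Part 1. `χ_n` and `B_n` at integer scales -/

section Lattice

variable {d : ℕ}

/-- `Λ_n` at an integer scale `n` is the cube `box d n`. [folklore] -/
theorem latticeBox_natCast (d n : ℕ) : latticeBox d (n : ℝ) = box d n := by
  rw [latticeBox_eq_box (Nat.cast_nonneg n), Nat.floor_natCast]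

/-- `χ_n = ∑_{x ∈ Λ_n} S(x)` at an integer scale `n`, as a sum over `box d n`. [folklore] -/
theorem boxSusceptibility_natCast (S : Site d → ℝ) (n : ℕ) :
    boxSusceptibility S n = ∑ x ∈ box d n, S x := by
  rw [boxSusceptibility, latticeBox_natCast]

/-- `B_n = ∑_{x ∈ Λ_n} S(x)²` at an integer scale `n`, as a sum over `box d n`. [folklore] -/
theorem bubbleDiagram_natCast (S : Site d → ℝ) (n : ℕ) :
    bubbleDiagram S n = ∑ x ∈ box d n, S x ^ 2 := by
  rw [bubbleDiagram, latticeBox_natCast]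

/-- `|Λ_n| = (2n+1)^d` in `ℝ`. [folklore] -/
theorem card_box_real (d n : ℕ) : (#(box d n) : ℝ) = (2 * (n : ℝ) + 1) ^ d := by
  rw [card_box]; push_cast; ring

/-- `χ_n ≥ 1` at integer scales when `S ≥ 0` and `S(0) = 1`. [folklore] -/
theorem one_le_boxSusceptibility_nat {S : Site d → ℝ} (h0 : ∀ x, 0 ≤ S x) (hS0 : S 0 = 1) (n : ℕ) :
    1 ≤ boxSusceptibility S (n : ℕ) := by
  calc (1 : ℝ) = boxSusceptibility S ((0 : ℕ) : ℝ) := by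
        rw [boxSusceptibility_natCast, sum_box_zero, hS0]
    _ ≤ boxSusceptibility S (n : ℕ) := boxSusceptibility_mono h0 (Nat.cast_le.2 (Nat.zero_le n))

/-- `χ_n ≤ |Λ_n|` when `S ≤ 1`. [folklore] -/
theorem boxSusceptibility_le_card_box {S : Site d → ℝ} (h1 : ∀ x, S x ≤ 1) (n : ℕ) :
    boxSusceptibility S (n : ℕ) ≤ #(box d n) := by
  rw [boxSusceptibility_natCast]
  calc ∑ x ∈ box d n, S x ≤ ∑ _x ∈ box d n, (1 : ℝ) := Finset.sum_le_sum fun x _ => h1 x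
    _ = #(box d n) := by rw [sum_const, nsmul_eq_mul, mul_one]

/-- Shell sums of squares: `B_m - B_n = ∑_{Λ_m ∖ Λ_n} S²` at integer scales `n ≤ m`. [folklore] -/
theorem bubbleDiagram_sub_nat (S : Site d → ℝ) {n m : ℕ} (h : n ≤ m) :
    bubbleDiagram S (m : ℕ) - bubbleDiagram S (n : ℕ) = ∑ x ∈ box d m \ box d n, S x ^ 2 := by
  rw [sub_eq_iff_eq_add, bubbleDiagram_natCast, bubbleDiagram_natCast, Finset.sum_sdiff (box_mono d h)]

/-- Shell sums: `χ_m - χ_n = ∑_{Λ_m ∖ Λ_n} S` at integer scales `n ≤ m`. [folklore] -/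
theorem boxSusceptibility_sub_nat (S : Site d → ℝ) {n m : ℕ} (h : n ≤ m) :
    boxSusceptibility S (m : ℕ) - boxSusceptibility S (n : ℕ) = ∑ x ∈ box d m \ box d n, S x := by
  rw [sub_eq_iff_eq_add, boxSusceptibility_natCast, boxSusceptibility_natCast,
    Finset.sum_sdiff (box_mono d h)]

/-- `χ_N ≥ θ N` from lower bounds `θ` on the sphere sums `∑_{∂Λ_n} S`, `1 ≤ n ≤ N`, for `S ≥ 0`.
[folklore] -/
theorem mul_le_boxSusceptibility_of_sphereSum {S : Site d → ℝ} (h0 : ∀ x, 0 ≤ S x) {θ : ℝ} {N : ℕ}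
    (hLB : ∀ n : ℕ, 1 ≤ n → n ≤ N → θ ≤ ∑ y ∈ sphere d n, S y) :
    θ * N ≤ boxSusceptibility S (N : ℕ) := by
  rw [boxSusceptibility_natCast, sum_box_eq_sum_sphere, Finset.sum_range_succ']
  have hsum : ∑ k ∈ Finset.range N, θ ≤ ∑ k ∈ Finset.range N, ∑ y ∈ sphere d (k + 1), S y :=
    Finset.sum_le_sum fun k hk => hLB (k + 1) (by omega) (by have := Finset.mem_range.1 hk; omega)
  rw [sum_const, card_range, nsmul_eq_mul, mul_comm] at hsum
  have h0' : 0 ≤ ∑ y ∈ sphere d 0, S y := Finset.sum_nonneg fun y _ => h0 y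
  linarith

end Lattice

/-! ### Part 2. The dyadic mechanism of Lemma 6.3 for an abstract two-point function on `ℤ⁴` -/

section Abstract

variable {S : Site 4 → ℝ}

/-- `|Λ_{2N}| ≤ 625 N⁴` on `ℤ⁴` for `N ≥ 1`. [folklore] -/
theorem card_box_two_mul_le {N : ℕ} (hN : 1 ≤ N) : (#(box 4 (2 * N)) : ℝ) ≤ 625 * (N : ℝ) ^ 4 := by
  rw [card_box_real]
  have h1 : (1 : ℝ) ≤ N := by exact_mod_cast hN
  have h5 : 2 * ((2 * N : ℕ) : ℝ) + 1 ≤ 5 * N := by push_cast; linarith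
  calc (2 * ((2 * N : ℕ) : ℝ) + 1) ^ 4 ≤ (5 * (N : ℝ)) ^ 4 := by gcongr
    _ = 625 * (N : ℝ) ^ 4 := by ring

/-- Messager–Miracle-Solé averaging: if `S(y) ≤ S(x)` whenever `4‖x‖_∞ ≤ ‖y‖_∞`, then for
`‖y‖_∞ > N`, `|Λ_{N/4}| S(y) ≤ χ_{N/4}` (Aizenman–Duminil-Copin 2021, first inequality of (6.3)).
[cite: AizenmanDuminilCopinAnnals2021, arXiv:1912.07973 Lemma 6.3, proof, display (6.3) (p. 21)] -/
theorem card_box_mul_le_boxSusceptibility_of_mms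
    (hMMS : ∀ x y : Site 4, 4 * Site.supNorm x ≤ Site.supNorm y → S y ≤ S x)
    {N : ℕ} {y : Site 4} (hy : N < Site.supNorm y) :
    (#(box 4 (N / 4)) : ℝ) * S y ≤ boxSusceptibility S (N / 4 : ℕ) := by
  rw [boxSusceptibility_natCast]
  calc (#(box 4 (N / 4)) : ℝ) * S y = ∑ _x ∈ box 4 (N / 4), S y := by rw [sum_const, nsmul_eq_mul]
    _ ≤ ∑ x ∈ box 4 (N / 4), S x := Finset.sum_le_sum fun x hx => by
        refine hMMS x y ?_
        have hx' := mem_box_iff_supNorm_le.1 hx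
        omega

/-- **The dyadic shell bound (Aizenman–Duminil-Copin 2021, display (6.3), first two
inequalities).** For `S` with `0 ≤ S ≤ 1`, `S(0) = 1`, the MMS comparison and the sliding-scale
bound `χ_m/m² ≤ K χ_n/n²` (`1 ≤ n ≤ m`): `B_{2N} - B_N ≤ K₁ χ_n²/n⁴` for all `1 ≤ n ≤ N`, with
`K₁ = 40960000 K² + 10485760000`. [cite: AizenmanDuminilCopinAnnals2021, arXiv:1912.07973 Lemma 6.3, proof, display (6.3) (p. 21)] -/
theorem bubbleDiagram_shell_le (h0 : ∀ x, 0 ≤ S x) (h1 : ∀ x, S x ≤ 1) (hS0 : S 0 = 1)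
    (hMMS : ∀ x y : Site 4, 4 * Site.supNorm x ≤ Site.supNorm y → S y ≤ S x)
    {K : ℝ} (hK : 1 ≤ K)
    (hT : ∀ n m : ℕ, 1 ≤ n → n ≤ m →
      boxSusceptibility S (m : ℕ) / (m : ℝ) ^ 2 ≤ K * (boxSusceptibility S (n : ℕ) / (n : ℝ) ^ 2))
    {n N : ℕ} (hn : 1 ≤ n) (hnN : n ≤ N) :
    bubbleDiagram S (2 * N : ℕ) - bubbleDiagram S (N : ℕ) ≤
      (40960000 * K ^ 2 + 10485760000) * boxSusceptibility S (n : ℕ) ^ 2 / (n : ℝ) ^ 4 := by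
  have hN : 1 ≤ N := hn.trans hnN
  have hn' : (1 : ℝ) ≤ n := by exact_mod_cast hn
  have hN' : (1 : ℝ) ≤ N := by exact_mod_cast hN
  have hnN' : (n : ℝ) ≤ N := by exact_mod_cast hnN
  have hχn : 1 ≤ boxSusceptibility S (n : ℕ) := one_le_boxSusceptibility_nat h0 hS0 n
  set m := N / 4 with hm
  -- a uniform bound `u` on `S` over the shell, and the resulting bound on the shell sum
  have shell_le : ∀ u : ℝ, (∀ y : Site 4, N < Site.supNorm y → S y ≤ u) →
      bubbleDiagram S (2 * N : ℕ) - bubbleDiagram S (N : ℕ) ≤ 625 * (N : ℝ) ^ 4 * u ^ 2 := by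
    intro u hu
    rw [bubbleDiagram_sub_nat S (by omega : N ≤ 2 * N)]
    have hsub : box 4 (2 * N) \ box 4 N ⊆ box 4 (2 * N) := Finset.sdiff_subset
    have hterm : ∀ y ∈ box 4 (2 * N) \ box 4 N, S y ^ 2 ≤ u ^ 2 := by
      intro y hy
      simp only [Finset.mem_sdiff, mem_box_iff_supNorm_le, not_le] at hy
      exact pow_le_pow_left₀ (h0 y) (hu y hy.2) 2
    calc ∑ y ∈ box 4 (2 * N) \ box 4 N, S y ^ 2 ≤ ∑ _y ∈ box 4 (2 * N) \ box 4 N, u ^ 2 :=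
          Finset.sum_le_sum hterm
      _ = #(box 4 (2 * N) \ box 4 N) * u ^ 2 := by rw [sum_const, nsmul_eq_mul]
      _ ≤ #(box 4 (2 * N)) * u ^ 2 :=
          mul_le_mul_of_nonneg_right (by exact_mod_cast card_le_card hsub) (sq_nonneg u)
      _ ≤ 625 * (N : ℝ) ^ 4 * u ^ 2 := by
          gcongr
          exact card_box_two_mul_le hN
  have hK0 : 0 ≤ K := zero_le_one.trans hK
  have hgoal_of : ∀ A : ℝ, bubbleDiagram S (2 * N : ℕ) - bubbleDiagram S (N : ℕ) ≤ A * boxSusceptibility S (n : ℕ) ^ 2 / (n : ℝ) ^ 4 →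
      A ≤ 40960000 * K ^ 2 + 10485760000 →
      bubbleDiagram S (2 * N : ℕ) - bubbleDiagram S (N : ℕ) ≤
        (40960000 * K ^ 2 + 10485760000) * boxSusceptibility S (n : ℕ) ^ 2 / (n : ℝ) ^ 4 := by
    intro A h hA
    refine h.trans ?_
    gcongr
  rcases lt_or_ge N 4 with hN4 | hN4
  · -- small `N`: the trivial bound `S ≤ 1`
    have hb := shell_le 1 fun y _ => h1 y
    have hN3 : (N : ℝ) ≤ 3 := by exact_mod_cast Nat.lt_succ_iff.1 hN4
    have hn3 : (n : ℝ) ≤ 3 := hnN'.trans hN3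
    refine hgoal_of 4100625 ?_ (by nlinarith)
    rw [le_div_iff₀ (by positivity)]
    calc (bubbleDiagram S (2 * N : ℕ) - bubbleDiagram S (N : ℕ)) * (n : ℝ) ^ 4 ≤ 625 * (N : ℝ) ^ 4 * 1 ^ 2 * 3 ^ 4 :=
          mul_le_mul hb (pow_le_pow_left₀ (by positivity) hn3 4) (by positivity) (by positivity)
      _ ≤ 625 * 3 ^ 4 * 1 ^ 2 * 3 ^ 4 := by gcongr
      _ = 4100625 * 1 ^ 2 := by norm_num
      _ ≤ 4100625 * boxSusceptibility S (n : ℕ) ^ 2 := by gcongr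
  · -- `N ≥ 4`: `m = N/4 ≥ 1`, `16 m ≥ N`, `4 m ≤ N`
    have hm1 : 1 ≤ m := by omega
    have h16m : N ≤ 16 * m := by omega
    have h4m : 4 * m ≤ N := by omega
    have hm1' : (1 : ℝ) ≤ m := by exact_mod_cast hm1
    have h16m' : (N : ℝ) ≤ 16 * m := by exact_mod_cast h16m
    have h4m' : 4 * (m : ℝ) ≤ N := by exact_mod_cast h4m
    have hcard : (N : ℝ) ^ 4 / 4096 ≤ #(box 4 m) := by
      rw [card_box_real]
      have : (N : ℝ) / 16 ≤ m := by linarith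
      calc (N : ℝ) ^ 4 / 4096 = ((N : ℝ) / 16) ^ 4 * 16 := by ring
        _ ≤ (m : ℝ) ^ 4 * 16 := by gcongr
        _ = (2 * (m : ℝ)) ^ 4 := by ring
        _ ≤ (2 * (m : ℝ) + 1) ^ 4 := by gcongr; linarith
    have havg : ∀ y : Site 4, N < Site.supNorm y → S y ≤ boxSusceptibility S (m : ℕ) * 4096 / (N : ℝ) ^ 4 := by
      intro y hy
      have h := card_box_mul_le_boxSusceptibility_of_mms hMMS hy
      rw [le_div_iff₀ (by positivity)]
      calc S y * (N : ℝ) ^ 4 = (N : ℝ) ^ 4 / 4096 * S y * 4096 := by ring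
        _ ≤ #(box 4 m) * S y * 4096 := by gcongr; exact h0 y
        _ ≤ boxSusceptibility S (m : ℕ) * 4096 := by gcongr
    rcases le_or_gt n m with hnm | hnm
    · -- `n ≤ m`: transfer from scale `m` to scale `n` by the sliding-scale bound
      have hTnm := hT n m hn hnm
      -- `χ_m ≤ K χ_n m²/n² ≤ K χ_n N²/(16 n²)`
      have hχm : boxSusceptibility S (m : ℕ) ≤ K * boxSusceptibility S (n : ℕ) * (N : ℝ) ^ 2 / (16 * (n : ℝ) ^ 2) := by
        rw [le_div_iff₀ (by positivity)]
        calc boxSusceptibility S (m : ℕ) * (16 * (n : ℝ) ^ 2) = boxSusceptibility S (m : ℕ) / (m : ℝ) ^ 2 * (m : ℝ) ^ 2 * (16 * (n : ℝ) ^ 2) := by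
              field_simp
          _ ≤ K * (boxSusceptibility S (n : ℕ) / (n : ℝ) ^ 2) * (m : ℝ) ^ 2 * (16 * (n : ℝ) ^ 2) := by gcongr
          _ = K * boxSusceptibility S (n : ℕ) * (4 * (m : ℝ)) ^ 2 := by field_simp; norm_num
          _ ≤ K * boxSusceptibility S (n : ℕ) * (N : ℝ) ^ 2 :=
              mul_le_mul_of_nonneg_left (pow_le_pow_left₀ (by positivity) h4m' 2)
                (mul_nonneg hK0 (boxSusceptibility_nonneg h0 _))
      have hu : ∀ y : Site 4, N < Site.supNorm y → S y ≤ 256 * K * boxSusceptibility S (n : ℕ) / ((n : ℝ) ^ 2 * (N : ℝ) ^ 2) := by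
        intro y hy
        refine (havg y hy).trans ?_
        rw [div_le_div_iff₀ (by positivity) (by positivity)]
        calc boxSusceptibility S (m : ℕ) * 4096 * ((n : ℝ) ^ 2 * (N : ℝ) ^ 2)
            ≤ K * boxSusceptibility S (n : ℕ) * (N : ℝ) ^ 2 / (16 * (n : ℝ) ^ 2) * 4096 * ((n : ℝ) ^ 2 * (N : ℝ) ^ 2) := by
              gcongr
          _ = 256 * K * boxSusceptibility S (n : ℕ) * (N : ℝ) ^ 4 := by field_simp; ring
      have hb := shell_le _ hu
      refine hgoal_of (40960000 * K ^ 2) (hb.trans (le_of_eq ?_)) (by linarith)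
      field_simp
      ring
    · -- `m < n ≤ N`: monotonicity `χ_m ≤ χ_n`
      have hχmn : boxSusceptibility S (m : ℕ) ≤ boxSusceptibility S (n : ℕ) := boxSusceptibility_mono h0 (Nat.cast_le.2 hnm.le)
      have hu : ∀ y : Site 4, N < Site.supNorm y → S y ≤ boxSusceptibility S (n : ℕ) * 4096 / (N : ℝ) ^ 4 := by
        intro y hy
        refine (havg y hy).trans ?_
        gcongr
      have hb := shell_le _ hu
      refine hgoal_of 10485760000 (hb.trans ?_) (by nlinarith)
      rw [div_pow, le_div_iff₀ (by positivity)]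
      calc 625 * (N : ℝ) ^ 4 * ((boxSusceptibility S (n : ℕ) * 4096) ^ 2 / ((N : ℝ) ^ 4) ^ 2) * (n : ℝ) ^ 4
          = 10485760000 * boxSusceptibility S (n : ℕ) ^ 2 * ((n : ℝ) ^ 4 / (N : ℝ) ^ 4) := by field_simp; ring
        _ ≤ 10485760000 * boxSusceptibility S (n : ℕ) ^ 2 * 1 := by
            gcongr
            rw [div_le_one (by positivity)]
            gcongr
        _ = 10485760000 * boxSusceptibility S (n : ℕ) ^ 2 := mul_one _

/-- **Cauchy–Schwarz on a dyadic shell (last inequality of (6.3)).** On `ℤ⁴`, for `n ≥ 1`,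
`(χ_{2n} - χ_n)² ≤ |Λ_{2n}| (B_{2n} - B_n) ≤ 625 n⁴ (B_{2n} - B_n)`. [cite: AizenmanDuminilCopinAnnals2021, arXiv:1912.07973 Lemma 6.3, proof, display (6.3) (p. 21)] -/
theorem sq_boxSusceptibility_sub_le (S : Site 4 → ℝ) {n : ℕ} (hn : 1 ≤ n) :
    (boxSusceptibility S (2 * n : ℕ) - boxSusceptibility S (n : ℕ)) ^ 2 ≤ 625 * (n : ℝ) ^ 4 * (bubbleDiagram S (2 * n : ℕ) - bubbleDiagram S (n : ℕ)) := by
  rw [boxSusceptibility_sub_nat S (by omega : n ≤ 2 * n), bubbleDiagram_sub_nat S (by omega : n ≤ 2 * n)]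
  have hcs := Finset.sum_mul_sq_le_sq_mul_sq (box 4 (2 * n) \ box 4 n) S (fun _ => (1 : ℝ))
  simp only [mul_one, one_pow, sum_const, nsmul_eq_mul] at hcs
  have hsub : box 4 (2 * n) \ box 4 n ⊆ box 4 (2 * n) := Finset.sdiff_subset
  have hcard : (#(box 4 (2 * n) \ box 4 n) : ℝ) ≤ 625 * (n : ℝ) ^ 4 :=
    le_trans (by exact_mod_cast card_le_card hsub) (card_box_two_mul_le hn)
  have hnn : 0 ≤ ∑ x ∈ box 4 (2 * n) \ box 4 n, S x ^ 2 := Finset.sum_nonneg fun _ _ => sq_nonneg _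
  calc (∑ x ∈ box 4 (2 * n) \ box 4 n, S x) ^ 2
      ≤ (∑ x ∈ box 4 (2 * n) \ box 4 n, S x ^ 2) * #(box 4 (2 * n) \ box 4 n) := hcs
    _ ≤ (∑ x ∈ box 4 (2 * n) \ box 4 n, S x ^ 2) * (625 * (n : ℝ) ^ 4) := by gcongr
    _ = 625 * (n : ℝ) ^ 4 * ∑ x ∈ box 4 (2 * n) \ box 4 n, S x ^ 2 := by ring

/-- **Property P4 converts `χ_n²/n⁴` into the shell of `B` (third and fourth inequalities of
(6.3)).** If `χ_{2n} ≥ (3/2) χ_n` (`n ≥ 1`, `S ≥ 0`) then `χ_n²/n⁴ ≤ 2500 (B_{2n} - B_n)`. [cite: AizenmanDuminilCopinAnnals2021, arXiv:1912.07973 Lemma 6.3, proof, display (6.3) (p. 21), with Def. 5.11 P4 (p. 20)] -/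
theorem sq_boxSusceptibility_div_le_of_regular (h0 : ∀ x, 0 ≤ S x) {n : ℕ} (hn : 1 ≤ n)
    (hreg : 3 / 2 * boxSusceptibility S (n : ℕ) ≤ boxSusceptibility S (2 * n : ℕ)) :
    boxSusceptibility S (n : ℕ) ^ 2 / (n : ℝ) ^ 4 ≤ 2500 * (bubbleDiagram S (2 * n : ℕ) - bubbleDiagram S (n : ℕ)) := by
  have hn' : (0 : ℝ) < n := by exact_mod_cast hn
  have hχ0 : 0 ≤ boxSusceptibility S (n : ℕ) := boxSusceptibility_nonneg h0 _
  have h1 : boxSusceptibility S (n : ℕ) ^ 2 ≤ 4 * (boxSusceptibility S (2 * n : ℕ) - boxSusceptibility S (n : ℕ)) ^ 2 := by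
    have : boxSusceptibility S (n : ℕ) ≤ 2 * (boxSusceptibility S (2 * n : ℕ) - boxSusceptibility S (n : ℕ)) := by linarith
    nlinarith
  have h2 := sq_boxSusceptibility_sub_le S hn
  rw [div_le_iff₀ (by positivity)]
  nlinarith


/-- Doubling bound from the sliding-scale bound: `χ_{2n} ≤ 4K χ_n` (`n ≥ 1`). [cite: AizenmanDuminilCopinAnnals2021, arXiv:1912.07973 Theorem 5.6 with L = 2ℓ (p. 18)] -/
theorem boxSusceptibility_double_le {K : ℝ}
    (hT : ∀ n m : ℕ, 1 ≤ n → n ≤ m →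
      boxSusceptibility S (m : ℕ) / (m : ℝ) ^ 2 ≤ K * (boxSusceptibility S (n : ℕ) / (n : ℝ) ^ 2))
    {n : ℕ} (hn : 1 ≤ n) : boxSusceptibility S (2 * n : ℕ) ≤ 4 * K * boxSusceptibility S (n : ℕ) := by
  have h := hT n (2 * n) hn (by omega)
  have hn' : (0 : ℝ) < n := by exact_mod_cast hn
  rw [div_le_iff₀ (by positivity)] at h
  calc boxSusceptibility S (2 * n : ℕ) ≤ K * (boxSusceptibility S (n : ℕ) / (n : ℝ) ^ 2) * ((2 * n : ℕ) : ℝ) ^ 2 := h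
    _ = 4 * K * boxSusceptibility S (n : ℕ) := by push_cast; field_simp; ring

/-- **Growth of `χ` along the dyadic scales, split by Property P4** (the pigeonhole behind
Aizenman–Duminil-Copin 2021, Thm 5.12, as used in Lemma 6.3): with `F_j` the set of `k < j`
at which `χ_{2^{k+1}} ≥ (3/2) χ_{2^k}` ("regular" for P4 with `1 + c = 3/2`),
`χ_{2^j} ≤ χ_1 (4K)^{|F_j|} (3/2)^j`. [cite: AizenmanDuminilCopinAnnals2021, arXiv:1912.07973 Theorem 5.12, proof (p. 20), and Lemma 6.3, proof (p. 21)] -/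
theorem boxSusceptibility_two_pow_le (h0 : ∀ x, 0 ≤ S x) {K : ℝ} (hK : 1 ≤ K)
    (hT : ∀ n m : ℕ, 1 ≤ n → n ≤ m →
      boxSusceptibility S (m : ℕ) / (m : ℝ) ^ 2 ≤ K * (boxSusceptibility S (n : ℕ) / (n : ℝ) ^ 2)) (j : ℕ) :
    boxSusceptibility S (2 ^ j : ℕ) ≤ boxSusceptibility S (1 : ℕ) *
      (4 * K) ^ #((Finset.range j).filter fun k => 3 / 2 * boxSusceptibility S (2 ^ k : ℕ) ≤ boxSusceptibility S (2 ^ (k + 1) : ℕ)) *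
        (3 / 2) ^ j := by
  induction j with
  | zero => simp
  | succ j ih =>
    set F := (Finset.range j).filter fun k => 3 / 2 * boxSusceptibility S (2 ^ k : ℕ) ≤ boxSusceptibility S (2 ^ (k + 1) : ℕ)
      with hF
    rw [Finset.range_add_one, Finset.filter_insert]
    have hχ0 : 0 ≤ boxSusceptibility S (1 : ℕ) := boxSusceptibility_nonneg h0 _
    have h4K : (0 : ℝ) ≤ 4 * K := by linarith
    by_cases hp : 3 / 2 * boxSusceptibility S (2 ^ j : ℕ) ≤ boxSusceptibility S (2 ^ (j + 1) : ℕ)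
    · rw [if_pos hp, Finset.card_insert_of_notMem (by simp)]
      have hd := boxSusceptibility_double_le hT (n := 2 ^ j) Nat.one_le_two_pow
      rw [← pow_succ'] at hd
      calc boxSusceptibility S (2 ^ (j + 1) : ℕ) ≤ 4 * K * boxSusceptibility S (2 ^ j : ℕ) := hd
        _ ≤ 4 * K * (boxSusceptibility S (1 : ℕ) * (4 * K) ^ #F * (3 / 2) ^ j) :=
            mul_le_mul_of_nonneg_left ih h4K
        _ = boxSusceptibility S (1 : ℕ) * (4 * K) ^ (#F + 1) * (3 / 2) ^ j * 1 := by ring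
        _ ≤ boxSusceptibility S (1 : ℕ) * (4 * K) ^ (#F + 1) * (3 / 2) ^ j * (3 / 2) :=
            mul_le_mul_of_nonneg_left (by norm_num) (by positivity)
        _ = boxSusceptibility S (1 : ℕ) * (4 * K) ^ (#F + 1) * (3 / 2) ^ (j + 1) := by ring
    · rw [if_neg hp]
      calc boxSusceptibility S (2 ^ (j + 1) : ℕ) ≤ 3 / 2 * boxSusceptibility S (2 ^ j : ℕ) := (not_le.1 hp).le
        _ ≤ 3 / 2 * (boxSusceptibility S (1 : ℕ) * (4 * K) ^ #F * (3 / 2) ^ j) :=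
            mul_le_mul_of_nonneg_left ih (by norm_num)
        _ = boxSusceptibility S (1 : ℕ) * (4 * K) ^ #F * (3 / 2) ^ (j + 1) := by ring

/-- **Abundance of P4-regular dyadic scales (counting form).** If moreover `S ≤ 1` (so
`χ_1 ≤ 81`) and the sphere sums satisfy `∑_{∂Λ_n} S ≥ θ` for `1 ≤ n ≤ 2^j` (so `χ_{2^j} ≥ θ 2^j`),
then `j log(4/3) ≤ log(81/θ) + |F_j| log(4K)` (Aizenman–Duminil-Copin 2021, Thm 5.12: "there
are at least `c log₂(N/n)` regular scales", here between `1` and `2^j`, for Property P4). [cite: AizenmanDuminilCopinAnnals2021, arXiv:1912.07973 Theorem 5.12, proof (p. 20)] -/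
theorem card_regular_ge (h0 : ∀ x, 0 ≤ S x) (h1 : ∀ x, S x ≤ 1) {K : ℝ} (hK : 1 ≤ K)
    (hT : ∀ n m : ℕ, 1 ≤ n → n ≤ m →
      boxSusceptibility S (m : ℕ) / (m : ℝ) ^ 2 ≤ K * (boxSusceptibility S (n : ℕ) / (n : ℝ) ^ 2))
    {θ : ℝ} (hθ : 0 < θ) (j : ℕ)
    (hLB : ∀ n : ℕ, 1 ≤ n → n ≤ 2 ^ j → θ ≤ ∑ y ∈ sphere 4 n, S y) :
    (j : ℝ) * Real.log (4 / 3) ≤ Real.log (81 / θ) +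
      #((Finset.range j).filter fun k => 3 / 2 * boxSusceptibility S (2 ^ k : ℕ) ≤ boxSusceptibility S (2 ^ (k + 1) : ℕ)) *
        Real.log (4 * K) := by
  set g := #((Finset.range j).filter fun k => 3 / 2 * boxSusceptibility S (2 ^ k : ℕ) ≤ boxSusceptibility S (2 ^ (k + 1) : ℕ))
    with hg
  have hlow : θ * (2 : ℝ) ^ j ≤ boxSusceptibility S (2 ^ j : ℕ) := by
    have := mul_le_boxSusceptibility_of_sphereSum h0 (N := 2 ^ j) hLB
    exact_mod_cast this
  have hup := boxSusceptibility_two_pow_le h0 hK hT j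
  have hχ1 : boxSusceptibility S (1 : ℕ) ≤ 81 := by
    have := boxSusceptibility_le_card_box h1 (d := 4) 1
    rw [card_box_real] at this
    norm_num at this
    exact_mod_cast this
  have h4K : (1 : ℝ) ≤ 4 * K := by linarith
  have hkey : (4 / 3 : ℝ) ^ j ≤ 81 / θ * (4 * K) ^ g := by
    have h2 : θ * (2 : ℝ) ^ j ≤ 81 * (4 * K) ^ g * (3 / 2) ^ j := by
      calc θ * (2 : ℝ) ^ j ≤ boxSusceptibility S (2 ^ j : ℕ) := hlow
        _ ≤ boxSusceptibility S (1 : ℕ) * (4 * K) ^ g * (3 / 2) ^ j := hup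
        _ ≤ 81 * (4 * K) ^ g * (3 / 2) ^ j := by gcongr
    rw [div_mul_eq_mul_div, le_div_iff₀ hθ]
    calc (4 / 3 : ℝ) ^ j * θ = θ * 2 ^ j / (3 / 2) ^ j := by
          rw [mul_comm, mul_div_assoc, ← div_pow]; norm_num
      _ ≤ 81 * (4 * K) ^ g * (3 / 2) ^ j / (3 / 2) ^ j := by gcongr
      _ = 81 * (4 * K) ^ g := by field_simp
  have hlog := Real.log_le_log (by positivity) hkey
  rw [Real.log_pow, Real.log_mul (by positivity) (by positivity), Real.log_pow] at hlog
  exact hlog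

/-- **Dyadic covering of `[ℓ, L]`.** For `1 ≤ ℓ ≤ L`, with `T = ⌊log₂ ⌊L/ℓ⌋⌋ + 1`:
`L ≤ 2^T ℓ` and `T ≤ 1 + log(L/ℓ)/log 2` ("there are `log₂(L/ℓ)` scales between `ℓ` and `L`").
[cite: AizenmanDuminilCopinAnnals2021, arXiv:1912.07973 Lemma 6.3, proof (p. 21)] -/
theorem dyadic_cover {ℓ L : ℕ} (hℓ : 1 ≤ ℓ) (hℓL : ℓ ≤ L) :
    L ≤ 2 ^ (Nat.log 2 (L / ℓ) + 1) * ℓ ∧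
      ((Nat.log 2 (L / ℓ) + 1 : ℕ) : ℝ) ≤ 1 + Real.log ((L : ℝ) / ℓ) / Real.log 2 := by
  set q := L / ℓ with hq
  have hq1 : 1 ≤ q := (Nat.le_div_iff_mul_le hℓ).2 (by simpa using hℓL)
  constructor
  · have hlt : q < 2 ^ (Nat.log 2 q + 1) := Nat.lt_pow_succ_log_self (by norm_num) q
    have : L < 2 ^ (Nat.log 2 q + 1) * ℓ := (Nat.div_lt_iff_lt_mul hℓ).1 hlt
    exact this.le
  · have hpow : 2 ^ Nat.log 2 q ≤ q := Nat.pow_log_le_self 2 (by omega)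
    have hqreal : (q : ℝ) ≤ (L : ℝ) / ℓ := by
      rw [hq]; exact Nat.cast_div_le
    have hq0 : (0 : ℝ) < q := by exact_mod_cast hq1
    have hlog2 : 0 < Real.log 2 := Real.log_pos (by norm_num)
    have h1 : (Nat.log 2 q : ℝ) * Real.log 2 ≤ Real.log ((L : ℝ) / ℓ) := by
      rw [← Real.log_pow]
      refine Real.log_le_log (by positivity) ?_
      calc (2 : ℝ) ^ Nat.log 2 q = ((2 ^ Nat.log 2 q : ℕ) : ℝ) := by push_cast; ring
        _ ≤ q := by exact_mod_cast hpow
        _ ≤ (L : ℝ) / ℓ := hqreal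
    have h2 : (Nat.log 2 q : ℝ) ≤ Real.log ((L : ℝ) / ℓ) / Real.log 2 := by
      rw [le_div_iff₀ hlog2]; exact h1
    push_cast
    linarith

/-- **Comparison of a far shell with the regular shells below `ℓ`** ("the sums of squared
correlations on any of the former contribute less to `B_L - B_ℓ` than any of the latter to
`B_ℓ`"): if `2^{K₀} ≤ ℓ ≤ N` and `G` is the set of P4-regular `k < K₀`, then
`|G| (B_{2N} - B_N) ≤ 2500 K₁ ∑_{k ∈ G} (B_{2^{k+1}} - B_{2^k}) ≤ 2500 K₁ B_ℓ`. [cite: AizenmanDuminilCopinAnnals2021, arXiv:1912.07973 Lemma 6.3, proof (p. 21)] -/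
theorem card_mul_shell_le (h0 : ∀ x, 0 ≤ S x) (h1 : ∀ x, S x ≤ 1) (hS0 : S 0 = 1)
    (hMMS : ∀ x y : Site 4, 4 * Site.supNorm x ≤ Site.supNorm y → S y ≤ S x)
    {K : ℝ} (hK : 1 ≤ K)
    (hT : ∀ n m : ℕ, 1 ≤ n → n ≤ m →
      boxSusceptibility S (m : ℕ) / (m : ℝ) ^ 2 ≤ K * (boxSusceptibility S (n : ℕ) / (n : ℝ) ^ 2))
    {K₀ ℓ N : ℕ} (hℓ : 2 ^ K₀ ≤ ℓ) (hℓN : ℓ ≤ N) :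
    #((Finset.range K₀).filter fun k => 3 / 2 * boxSusceptibility S (2 ^ k : ℕ) ≤ boxSusceptibility S (2 ^ (k + 1) : ℕ)) *
        (bubbleDiagram S (2 * N : ℕ) - bubbleDiagram S (N : ℕ)) ≤
      2500 * (40960000 * K ^ 2 + 10485760000) * bubbleDiagram S (ℓ : ℕ) := by
  set K₁ : ℝ := 40960000 * K ^ 2 + 10485760000 with hK₁
  set G := (Finset.range K₀).filter fun k => 3 / 2 * boxSusceptibility S (2 ^ k : ℕ) ≤ boxSusceptibility S (2 ^ (k + 1) : ℕ)
    with hG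
  have hK₁0 : 0 ≤ K₁ := by positivity
  -- each regular shell dominates the far shell
  have hk : ∀ k ∈ G, bubbleDiagram S (2 * N : ℕ) - bubbleDiagram S (N : ℕ) ≤
      2500 * K₁ * (bubbleDiagram S (2 ^ (k + 1) : ℕ) - bubbleDiagram S (2 ^ k : ℕ)) := by
    intro k hkG
    rw [hG, Finset.mem_filter, Finset.mem_range] at hkG
    obtain ⟨hkK, hreg⟩ := hkG
    have hn : 1 ≤ 2 ^ k := Nat.one_le_two_pow
    have hnN : 2 ^ k ≤ N := ((Nat.pow_le_pow_right (by norm_num) hkK.le).trans hℓ).trans hℓN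
    have hs := bubbleDiagram_shell_le h0 h1 hS0 hMMS hK hT hn hnN
    rw [pow_succ'] at hreg
    have hr := sq_boxSusceptibility_div_le_of_regular h0 hn hreg
    rw [← pow_succ'] at hr
    calc bubbleDiagram S (2 * N : ℕ) - bubbleDiagram S (N : ℕ) ≤ K₁ * boxSusceptibility S (2 ^ k : ℕ) ^ 2 / ((2 ^ k : ℕ) : ℝ) ^ 4 := hs
      _ = K₁ * (boxSusceptibility S (2 ^ k : ℕ) ^ 2 / ((2 ^ k : ℕ) : ℝ) ^ 4) := mul_div_assoc _ _ _
      _ ≤ K₁ * (2500 * (bubbleDiagram S (2 ^ (k + 1) : ℕ) - bubbleDiagram S (2 ^ k : ℕ))) :=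
          mul_le_mul_of_nonneg_left hr hK₁0
      _ = 2500 * K₁ * (bubbleDiagram S (2 ^ (k + 1) : ℕ) - bubbleDiagram S (2 ^ k : ℕ)) := by ring
  -- sum over the regular scales, then over all dyadic scales below `ℓ` (telescoping)
  have hmono : ∀ k, 0 ≤ bubbleDiagram S (2 ^ (k + 1) : ℕ) - bubbleDiagram S (2 ^ k : ℕ) := fun k =>
    sub_nonneg.2 (bubbleDiagram_mono S (Nat.cast_le.2 (Nat.pow_le_pow_right (by norm_num) (Nat.le_succ k))))
  calc (#G : ℝ) * (bubbleDiagram S (2 * N : ℕ) - bubbleDiagram S (N : ℕ))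
      = ∑ _k ∈ G, (bubbleDiagram S (2 * N : ℕ) - bubbleDiagram S (N : ℕ)) := by rw [sum_const, nsmul_eq_mul]
    _ ≤ ∑ k ∈ G, 2500 * K₁ * (bubbleDiagram S (2 ^ (k + 1) : ℕ) - bubbleDiagram S (2 ^ k : ℕ)) := Finset.sum_le_sum hk
    _ = 2500 * K₁ * ∑ k ∈ G, (bubbleDiagram S (2 ^ (k + 1) : ℕ) - bubbleDiagram S (2 ^ k : ℕ)) := by rw [Finset.mul_sum]
    _ ≤ 2500 * K₁ * ∑ k ∈ Finset.range K₀, (bubbleDiagram S (2 ^ (k + 1) : ℕ) - bubbleDiagram S (2 ^ k : ℕ)) := by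
        refine mul_le_mul_of_nonneg_left ?_ (by positivity)
        exact Finset.sum_le_sum_of_subset_of_nonneg (Finset.filter_subset _ _) fun k _ _ => hmono k
    _ = 2500 * K₁ * (bubbleDiagram S (2 ^ K₀ : ℕ) - bubbleDiagram S (2 ^ 0 : ℕ)) := by
        rw [Finset.sum_range_sub (fun k => bubbleDiagram S (2 ^ k : ℕ)) K₀]
    _ ≤ 2500 * K₁ * bubbleDiagram S (ℓ : ℕ) := by
        refine mul_le_mul_of_nonneg_left ?_ (by positivity)
        have h1' : 0 ≤ bubbleDiagram S (2 ^ 0 : ℕ) := bubbleDiagram_nonneg S _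
        have h2' : bubbleDiagram S (2 ^ K₀ : ℕ) ≤ bubbleDiagram S (ℓ : ℕ) := bubbleDiagram_mono S (Nat.cast_le.2 hℓ)
        linarith

/-- `log 2 ≤ 1`. [folklore] -/
theorem log_two_le_one : Real.log 2 ≤ 1 := by
  have := Real.log_two_lt_d9
  linarith

/-- **Aizenman–Duminil-Copin 2021, Lemma 6.3, abstract form on `ℤ⁴`.** Let `K ≥ 1` and
`0 < θ ≤ 1`. There is `C = C(K, θ) > 0` such that for every `S : ℤ⁴ → [0, 1]` with `S(0) = 1`,
the Messager–Miracle-Solé comparison `S(y) ≤ S(x)` for `4‖x‖_∞ ≤ ‖y‖_∞`, the sliding-scale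
bound `χ_m/m² ≤ K χ_n/n²` (`1 ≤ n ≤ m`), and every `2 ≤ ℓ ≤ L` such that the sphere sums satisfy
`∑_{∂Λ_n} S ≥ θ` for `1 ≤ n ≤ L`: `B_L ≤ (1 + C (1 + log(L/ℓ))/log ℓ) B_ℓ`. This is the printed
proof of Lemma 6.3 (display (6.3), abundance of P4-regular scales, dyadic bookkeeping) with the
inputs of §5 abstracted into hypotheses. [cite: AizenmanDuminilCopinAnnals2021, arXiv:1912.07973 Lemma 6.3 and its proof (p. 21)] -/
theorem bubbleDiagram_growth_abstract (K θ : ℝ) (hK : 1 ≤ K) (hθ : 0 < θ) (hθ1 : θ ≤ 1) :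
    ∃ C : ℝ, 0 < C ∧ ∀ (S : Site 4 → ℝ), (∀ x, 0 ≤ S x) → (∀ x, S x ≤ 1) → S 0 = 1 →
      (∀ x y : Site 4, 4 * Site.supNorm x ≤ Site.supNorm y → S y ≤ S x) →
      (∀ n m : ℕ, 1 ≤ n → n ≤ m →
        boxSusceptibility S (m : ℕ) / (m : ℝ) ^ 2 ≤ K * (boxSusceptibility S (n : ℕ) / (n : ℝ) ^ 2)) →
      ∀ (ℓ L : ℕ), 2 ≤ ℓ → ℓ ≤ L →
      (∀ n : ℕ, 1 ≤ n → n ≤ L → θ ≤ ∑ y ∈ sphere 4 n, S y) →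
      bubbleDiagram S (L : ℕ) ≤ (1 + C * (1 + Real.log ((L : ℝ) / ℓ)) / Real.log ℓ) * bubbleDiagram S (ℓ : ℕ) := by
  -- the constants
  set K₁ : ℝ := 40960000 * K ^ 2 + 10485760000 with hK₁
  set A : ℝ := Real.log (4 / 3) / Real.log 2 with hA
  set D : ℝ := Real.log (4 / 3) + Real.log (81 / θ) with hD
  set cG : ℝ := A / (2 * Real.log (4 * K)) with hcG
  set C₁ : ℝ := 2500 * K₁ / (cG * Real.log 2) with hC₁
  set C₂ : ℝ := 6561 * K₁ * (2 * D / A) / Real.log 2 with hC₂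
  have hlog2 : 0 < Real.log 2 := Real.log_pos (by norm_num)
  have hlog43 : 0 < Real.log (4 / 3) := Real.log_pos (by norm_num)
  have hlog4K : 0 < Real.log (4 * K) := Real.log_pos (by linarith)
  have hlog81 : 0 ≤ Real.log (81 / θ) := Real.log_nonneg (by rw [le_div_iff₀ hθ]; linarith)
  have hK₁ : 0 < K₁ := by positivity
  have hA0 : 0 < A := by positivity
  have hD0 : 0 < D := by positivity
  have hcG0 : 0 < cG := by positivity
  have hC₁0 : 0 < C₁ := by positivity
  have hC₂0 : 0 < C₂ := by positivity
  refine ⟨C₁ + C₂, by positivity, ?_⟩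
  intro S h0 h1 hS0 hMMS hT ℓ L hℓ2 hℓL hLB
  have hℓ1 : 1 ≤ ℓ := by omega
  have hℓreal : (2 : ℝ) ≤ ℓ := by exact_mod_cast hℓ2
  have hlogℓ : 0 < Real.log ℓ := Real.log_pos (by linarith)
  have hLℓ : (1 : ℝ) ≤ (L : ℝ) / ℓ := by
    rw [le_div_iff₀ (by positivity), one_mul]; exact_mod_cast hℓL
  have hlogLℓ : 0 ≤ Real.log ((L : ℝ) / ℓ) := Real.log_nonneg hLℓ
  have hBℓ : 1 ≤ bubbleDiagram S (ℓ : ℕ) := one_le_bubbleDiagram hS0 (Nat.cast_nonneg _)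
  -- dyadic covering of `[ℓ, L]`
  obtain ⟨hcov, hTle⟩ := dyadic_cover hℓ1 hℓL
  set T := Nat.log 2 (L / ℓ) + 1 with hTdef
  have hTle' : (T : ℝ) ≤ (1 + Real.log ((L : ℝ) / ℓ)) / Real.log 2 := by
    have h1 : (1 : ℝ) ≤ 1 / Real.log 2 := by
      rw [le_div_iff₀ hlog2, one_mul]; exact log_two_le_one
    calc (T : ℝ) ≤ 1 + Real.log ((L : ℝ) / ℓ) / Real.log 2 := hTle
      _ ≤ 1 / Real.log 2 + Real.log ((L : ℝ) / ℓ) / Real.log 2 := by linarith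
      _ = (1 + Real.log ((L : ℝ) / ℓ)) / Real.log 2 := by ring
  have htel : bubbleDiagram S (2 ^ T * ℓ : ℕ) - bubbleDiagram S (ℓ : ℕ) =
      ∑ t ∈ Finset.range T, (bubbleDiagram S (2 ^ (t + 1) * ℓ : ℕ) - bubbleDiagram S (2 ^ t * ℓ : ℕ)) := by
    rw [Finset.sum_range_sub (fun t => bubbleDiagram S (2 ^ t * ℓ : ℕ)) T]
    simp
  -- the regular dyadic scales below `ℓ`
  set K₀ := Nat.log 2 ℓ with hK₀
  have hK₀ℓ : 2 ^ K₀ ≤ ℓ := Nat.pow_log_le_self 2 (by omega)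
  have hℓlt : ℓ < 2 ^ (K₀ + 1) := Nat.lt_pow_succ_log_self one_lt_two ℓ
  set G := (Finset.range K₀).filter fun k => 3 / 2 * boxSusceptibility S (2 ^ k : ℕ) ≤ boxSusceptibility S (2 ^ (k + 1) : ℕ)
    with hG
  have hcount := card_regular_ge h0 h1 hK hT hθ K₀
    (fun n hn hnK => hLB n hn (hnK.trans (hK₀ℓ.trans hℓL)))
  have hK₀real : Real.log ℓ / Real.log 2 - 1 ≤ K₀ := by
    have h : Real.log ℓ < ((K₀ + 1 : ℕ) : ℝ) * Real.log 2 := by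
      rw [← Real.log_pow]
      refine Real.log_lt_log (by positivity) ?_
      exact_mod_cast hℓlt
    push_cast at h
    rw [sub_le_iff_le_add, div_le_iff₀ hlog2]
    exact h.le
  -- each far shell, crude bound (scale `n = 1`)
  have hshell_crude : ∀ t ∈ Finset.range T,
      bubbleDiagram S (2 ^ (t + 1) * ℓ : ℕ) - bubbleDiagram S (2 ^ t * ℓ : ℕ) ≤ 6561 * K₁ := by
    intro t _
    have hN : 1 ≤ 2 ^ t * ℓ := Nat.one_le_iff_ne_zero.2 (by positivity)
    have hs := bubbleDiagram_shell_le h0 h1 hS0 hMMS hK hT (le_refl 1) hN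
    have hχ1 : boxSusceptibility S (1 : ℕ) ≤ 81 := by
      have := boxSusceptibility_le_card_box h1 (d := 4) 1
      rw [card_box_real] at this
      norm_num at this
      exact_mod_cast this
    have hχ0 : 0 ≤ boxSusceptibility S (1 : ℕ) := boxSusceptibility_nonneg h0 _
    rw [show 2 ^ (t + 1) * ℓ = 2 * (2 ^ t * ℓ) by ring]
    calc bubbleDiagram S (2 * (2 ^ t * ℓ) : ℕ) - bubbleDiagram S (2 ^ t * ℓ : ℕ)
        ≤ K₁ * boxSusceptibility S (1 : ℕ) ^ 2 / ((1 : ℕ) : ℝ) ^ 4 := hs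
      _ = K₁ * boxSusceptibility S (1 : ℕ) ^ 2 := by norm_num
      _ ≤ K₁ * 81 ^ 2 := by gcongr
      _ = 6561 * K₁ := by ring
  -- each far shell, regular bound
  have hshell_reg : ∀ t ∈ Finset.range T,
      (#G : ℝ) * (bubbleDiagram S (2 ^ (t + 1) * ℓ : ℕ) - bubbleDiagram S (2 ^ t * ℓ : ℕ)) ≤ 2500 * K₁ * bubbleDiagram S (ℓ : ℕ) := by
    intro t _
    have hN : ℓ ≤ 2 ^ t * ℓ := Nat.le_mul_of_pos_left ℓ (by positivity)
    rw [show 2 ^ (t + 1) * ℓ = 2 * (2 ^ t * ℓ) by ring]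
    exact card_mul_shell_le h0 h1 hS0 hMMS hK hT hK₀ℓ hN
  -- the two regimes
  have key : bubbleDiagram S (2 ^ T * ℓ : ℕ) - bubbleDiagram S (ℓ : ℕ) ≤
      (C₁ + C₂) * (1 + Real.log ((L : ℝ) / ℓ)) / Real.log ℓ * bubbleDiagram S (ℓ : ℕ) := by
    have hfac : 0 ≤ (1 + Real.log ((L : ℝ) / ℓ)) / Real.log ℓ * bubbleDiagram S (ℓ : ℕ) := by positivity
    rcases le_or_gt (2 * D / A) (Real.log ℓ) with hreg | hsmall
    · -- enough regular scales: `|G| ≥ cG log ℓ`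
      have hG : cG * Real.log ℓ ≤ #G := by
        have h2D : 2 * D ≤ A * Real.log ℓ := by
          have := (div_le_iff₀ hA0).1 hreg
          linarith
        have h3 : A * Real.log ℓ - Real.log (4 / 3) ≤ (K₀ : ℝ) * Real.log (4 / 3) := by
          have := mul_le_mul_of_nonneg_right hK₀real hlog43.le
          calc A * Real.log ℓ - Real.log (4 / 3)
              = (Real.log ℓ / Real.log 2 - 1) * Real.log (4 / 3) := by rw [hA]; ring
            _ ≤ (K₀ : ℝ) * Real.log (4 / 3) := this
        have h4 : A * Real.log ℓ / 2 ≤ (#G : ℝ) * Real.log (4 * K) := by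
          have : A * Real.log ℓ - D ≤ (#G : ℝ) * Real.log (4 * K) := by rw [hD]; linarith
          linarith
        rw [hcG]
        calc A / (2 * Real.log (4 * K)) * Real.log ℓ = A * Real.log ℓ / 2 / Real.log (4 * K) := by
              field_simp
          _ ≤ (#G : ℝ) * Real.log (4 * K) / Real.log (4 * K) := by gcongr
          _ = #G := by field_simp
      have hGpos : (0 : ℝ) < #G := lt_of_lt_of_le (by positivity) hG
      calc bubbleDiagram S (2 ^ T * ℓ : ℕ) - bubbleDiagram S (ℓ : ℕ)
          = ∑ t ∈ Finset.range T, (bubbleDiagram S (2 ^ (t + 1) * ℓ : ℕ) - bubbleDiagram S (2 ^ t * ℓ : ℕ)) := htel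
        _ ≤ ∑ _t ∈ Finset.range T, 2500 * K₁ * bubbleDiagram S (ℓ : ℕ) / #G := by
            refine Finset.sum_le_sum fun t ht => ?_
            rw [le_div_iff₀ hGpos, mul_comm]
            exact hshell_reg t ht
        _ = T * (2500 * K₁ * bubbleDiagram S (ℓ : ℕ) / #G) := by rw [sum_const, card_range, nsmul_eq_mul]
        _ ≤ (1 + Real.log ((L : ℝ) / ℓ)) / Real.log 2 * (2500 * K₁ * bubbleDiagram S (ℓ : ℕ) / (cG * Real.log ℓ)) := by
            refine mul_le_mul hTle' ?_ (by positivity) (by positivity)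
            exact div_le_div_of_nonneg_left (by positivity) (by positivity) hG
        _ = C₁ * (1 + Real.log ((L : ℝ) / ℓ)) / Real.log ℓ * bubbleDiagram S (ℓ : ℕ) := by
            rw [hC₁]; field_simp
        _ ≤ (C₁ + C₂) * (1 + Real.log ((L : ℝ) / ℓ)) / Real.log ℓ * bubbleDiagram S (ℓ : ℕ) := by
            rw [mul_div_assoc, mul_div_assoc, mul_assoc, mul_assoc]
            exact mul_le_mul_of_nonneg_right (by linarith) hfac
    · -- few scales below `ℓ`: `log ℓ < 2D/A`, crude bound and `B_ℓ ≥ 1`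
      have hsmall' : 1 ≤ 2 * D / A / Real.log ℓ := by
        rw [le_div_iff₀ hlogℓ, one_mul]; exact hsmall.le
      calc bubbleDiagram S (2 ^ T * ℓ : ℕ) - bubbleDiagram S (ℓ : ℕ)
          = ∑ t ∈ Finset.range T, (bubbleDiagram S (2 ^ (t + 1) * ℓ : ℕ) - bubbleDiagram S (2 ^ t * ℓ : ℕ)) := htel
        _ ≤ ∑ _t ∈ Finset.range T, 6561 * K₁ := Finset.sum_le_sum hshell_crude
        _ = T * (6561 * K₁) := by rw [sum_const, card_range, nsmul_eq_mul]
        _ ≤ (1 + Real.log ((L : ℝ) / ℓ)) / Real.log 2 * (6561 * K₁) :=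
            mul_le_mul_of_nonneg_right hTle' (by positivity)
        _ = (1 + Real.log ((L : ℝ) / ℓ)) / Real.log 2 * (6561 * K₁) * 1 * 1 := by ring
        _ ≤ (1 + Real.log ((L : ℝ) / ℓ)) / Real.log 2 * (6561 * K₁) * (2 * D / A / Real.log ℓ) *
              bubbleDiagram S (ℓ : ℕ) := by
            gcongr
        _ = C₂ * (1 + Real.log ((L : ℝ) / ℓ)) / Real.log ℓ * bubbleDiagram S (ℓ : ℕ) := by
            rw [hC₂]; field_simp
        _ ≤ (C₁ + C₂) * (1 + Real.log ((L : ℝ) / ℓ)) / Real.log ℓ * bubbleDiagram S (ℓ : ℕ) := by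
            rw [mul_div_assoc, mul_div_assoc, mul_assoc, mul_assoc]
            exact mul_le_mul_of_nonneg_right (by linarith) hfac
  -- conclusion
  calc bubbleDiagram S (L : ℕ) ≤ bubbleDiagram S (2 ^ T * ℓ : ℕ) := bubbleDiagram_mono S (Nat.cast_le.2 hcov)
    _ ≤ bubbleDiagram S (ℓ : ℕ) + (C₁ + C₂) * (1 + Real.log ((L : ℝ) / ℓ)) / Real.log ℓ * bubbleDiagram S (ℓ : ℕ) := by
        linarith
    _ = (1 + (C₁ + C₂) * (1 + Real.log ((L : ℝ) / ℓ)) / Real.log ℓ) * bubbleDiagram S (ℓ : ℕ) := by ring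

end Abstract


/-! ### Part 3. Inputs from the plus state of the nearest-neighbour Ising model -/

section PlusState

variable {d : ℕ} {β : ℝ}

/-- The sup norm of `m eᵢ` is `|m|`. [folklore] -/
theorem Site.supNorm_single (i : Fin d) (m : ℤ) : Site.supNorm (Pi.single i m : Site d) = m.natAbs := by
  apply le_antisymm
  · rw [Site.supNorm_le_iff]
    intro j
    by_cases hj : j = i
    · subst hj; simp
    · rw [Pi.single_eq_of_ne hj]; simp
  · have := Site.natAbs_le_supNorm (Pi.single i m : Site d) i
    simpa using this

/-- `M • e₀ = M e₀` (the sites along the first axis in `invCorrLength`). [folklore] -/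
theorem zsmul_single_zero_one [NeZero d] (M : ℕ) :
    ((M : ℤ) • Pi.single (0 : Fin d) (1 : ℤ) : Site d) = Pi.single 0 (M : ℤ) := by
  ext j
  by_cases hj : j = 0
  · subst hj; simp
  · simp [Pi.single_eq_of_ne hj]

/-- **GKS II along a path**: `⟨σ₀σ_x⟩⁺ ⟨σ₀σ_{y-x}⟩⁺ ≤ ⟨σ₀σ_y⟩⁺` for `β ≥ 0` (Griffiths' second
inequality `⟨σ_A⟩⟨σ_B⟩ ≤ ⟨σ_{AΔB}⟩` with `A = {0, x}`, `B = {x, y}`, and translation invariance of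
the plus state; Friedli–Velenik 2017, Thm. 3.20, eq. (3.22), in the limit). [cite: FriedliVelenik2017, Thm. 3.20, eq. (3.22), p. 109] -/
theorem twoPointPlus_mul_le_twoPointPlus (hβ : 0 ≤ β) (x y : Site d) :
    twoPointPlus d β x * twoPointPlus d β (y - x) ≤ twoPointPlus d β y := by
  have h0 : ∀ z : Site d, 0 ≤ twoPointPlus d β z := twoPointPlus_nonneg_of_gks hβ
  have h1 : ∀ z : Site d, twoPointPlus d β z ≤ 1 := twoPointPlus_le_one_of_nonneg hβ
  by_cases hx : x = 0
  · subst hx; rw [twoPointPlus_zero, one_mul, sub_zero]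
  by_cases hxy : y = x
  · subst hxy; rw [sub_self, twoPointPlus_zero, mul_one]
  by_cases hy : y = 0
  · subst hy
    calc twoPointPlus d β x * twoPointPlus d β (0 - x) ≤ 1 * 1 :=
          mul_le_mul (h1 x) (h1 _) (h0 _) zero_le_one
      _ = twoPointPlus d β 0 := by rw [mul_one, twoPointPlus_zero]
  -- general position: GKS II for `A = {0, x}`, `B = {x, y}`, `A Δ B = {0, y}`
  have hsd : ({0, x} : Finset (Site d)) ∆ {x, y} = {0, y} := by
    ext z
    rw [Finset.mem_symmDiff]
    simp only [Finset.mem_insert, Finset.mem_singleton]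
    constructor
    · rintro (⟨hz | hz, hz'⟩ | ⟨hz | hz, hz'⟩)
      · exact Or.inl hz
      · exact absurd (Or.inl hz) hz'
      · exact absurd (Or.inr hz) hz'
      · exact Or.inr hz
    · rintro (hz | hz)
      · subst hz
        exact Or.inl ⟨Or.inl rfl, fun h => h.elim (fun h => hx h.symm) fun h => hy h.symm⟩
      · subst hz
        exact Or.inr ⟨Or.inr rfl, fun h => h.elim (fun h => hy h) fun h => hxy h⟩
  have hgks := plusCorr_mul_le hβ le_rfl ({0, x} : Finset (Site d)) {x, y}
  rw [hsd] at hgks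
  have hpair : plusCorr d β 0 {x, y} = twoPointPlus d β (y - x) := by
    rw [← plusPair_eq_twoPointPlus_sub hβ x y, plusPair, plusCorr, spinPair_eq_spinProduct (Ne.symm hxy)]
  rwa [← twoPointPlus_eq_plusCorr β hx, ← twoPointPlus_eq_plusCorr β hy, hpair] at hgks

/-- **Supermultiplicativity along an axis**: `⟨σ₀σ_{M eᵢ}⟩⁺_β ≥ (⟨σ₀σ_{eᵢ}⟩⁺_β)^M` for `β ≥ 0`
(iterate GKS II along the axis; Friedli–Velenik 2017, §3.10.7 / Exercise 3.26, existence of the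
correlation length by subadditivity). [cite: FriedliVelenik2017, Thm. 3.20, eq. (3.22), p. 109] -/
theorem pow_le_twoPointPlus_single (hβ : 0 ≤ β) (i : Fin d) (M : ℕ) :
    twoPointPlus d β (Pi.single i 1) ^ M ≤ twoPointPlus d β (Pi.single i (M : ℤ)) := by
  induction M with
  | zero => simp [twoPointPlus_zero]
  | succ M ih =>
    have h := twoPointPlus_mul_le_twoPointPlus hβ (Pi.single i (M : ℤ)) (Pi.single i ((M + 1 : ℕ) : ℤ))
    have hsub : (Pi.single i ((M + 1 : ℕ) : ℤ) : Site d) - Pi.single i (M : ℤ) = Pi.single i 1 := by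
      rw [← Pi.single_sub]
      congr 1
      push_cast
      ring
    rw [hsub] at h
    calc twoPointPlus d β (Pi.single i 1) ^ (M + 1)
        = twoPointPlus d β (Pi.single i 1) ^ M * twoPointPlus d β (Pi.single i 1) := pow_succ _ _
      _ ≤ twoPointPlus d β (Pi.single i (M : ℤ)) * twoPointPlus d β (Pi.single i 1) :=
          mul_le_mul_of_nonneg_right ih (twoPointPlus_nonneg_of_gks hβ _)
      _ ≤ twoPointPlus d β (Pi.single i ((M + 1 : ℕ) : ℤ)) := h

/-- **The correlation-length window forces `ψ_β(Λ_n) ≥ e^{-(n+2)/L}`** (the lower-bound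
mechanism of Aizenman–Duminil-Copin 2021, Cor. 5.8 / proof of Thm 5.12, in the tree's language:
the iterated boundary inequality `⟨σ₀σ_z⟩⁺ ≤ ψ_β(Λ_n)^k` for `‖z‖_∞ > k(n+2)`
(`twoPointPlus_le_bdryPsi_pow`, after Duminil-Copin 2019, proof of Thm. 4.8) gives
`ξ(β)⁻¹ = liminf -log⟨σ₀σ_{M e₁}⟩⁺/M ≥ -log ψ_β(Λ_n)/(n+2)`, so that `L ξ(β)⁻¹ ≤ 1` implies
`ψ_β(Λ_n) ≥ exp(-(n+2)/L)`). Requires `⟨σ₀σ_{e₁}⟩⁺_β > 0` (then `⟨σ₀σ_{Me₁}⟩⁺ ≥ ⟨σ₀σ_{e₁}⟩⁺^M`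
keeps the `liminf` finite). [cite: AizenmanDuminilCopinAnnals2021, arXiv:1912.07973 Cor. 5.8 and its proof (p. 19)] [cite: DuminilCopin2019, proof of Thm. 4.8, §4.4] -/
theorem exp_le_bdryPsi_of_invCorrLength [NeZero d] (hβ : 0 ≤ β) {L : ℝ} (hL : 0 < L)
    (hwin : L * invCorrLength (twoPointPlus d β) ≤ 1)
    (hpos : 0 < twoPointPlus d β (Pi.single 0 1)) (n : ℕ) :
    Real.exp (-((n : ℝ) + 2) / L) ≤ bdryPsi d β (box d n) := by
  set ψ := bdryPsi d β (box d n) with hψ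
  set q := twoPointPlus d β (Pi.single 0 1) with hq
  have hψ0 : 0 ≤ ψ := bdryPsi_nonneg hβ _
  have hn2 : (0 : ℝ) < (n : ℝ) + 2 := by positivity
  rcases le_or_gt 1 ψ with h1ψ | hψ1
  · refine le_trans (Real.exp_le_one_iff.2 ?_) h1ψ
    rw [neg_div]
    exact neg_nonpos.2 (div_nonneg hn2.le hL.le)
  have hq1 : q ≤ 1 := twoPointPlus_le_one_of_nonneg hβ _
  have haxis : ∀ M : ℕ, q ^ M ≤ twoPointPlus d β ((M : ℤ) • Pi.single (0 : Fin d) (1 : ℤ)) :=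
    fun M => by rw [zsmul_single_zero_one]; exact pow_le_twoPointPlus_single hβ 0 M
  have haxis_pos : ∀ M : ℕ, 0 < twoPointPlus d β ((M : ℤ) • Pi.single (0 : Fin d) (1 : ℤ)) :=
    fun M => lt_of_lt_of_le (pow_pos hpos M) (haxis M)
  have hnorm : ∀ M : ℕ, Site.supNorm ((M : ℤ) • Pi.single (0 : Fin d) (1 : ℤ) : Site d) = M :=
    fun M => by rw [zsmul_single_zero_one, Site.supNorm_single]; simp
  -- `ψ > 0`: otherwise `⟨σ₀σ_z⟩⁺ = 0` far away, contradicting positivity along the axis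
  have hψpos : 0 < ψ := by
    rcases hψ0.lt_or_eq with h | h
    · exact h
    · exfalso
      have hfar := twoPointPlus_le_bdryPsi_pow hβ n 1 ((((n + 3 : ℕ) : ℤ)) • Pi.single (0 : Fin d) (1 : ℤ))
        (by rw [hnorm]; omega)
      rw [← hψ, ← h, pow_one] at hfar
      exact absurd hfar (not_le.2 (haxis_pos (n + 3)))
  -- the sequence defining `ξ⁻¹`
  set u : ℕ → ℝ := fun M => -Real.log |twoPointPlus d β ((M : ℤ) • Pi.single (0 : Fin d) (1 : ℤ))| / M
    with hu
  have hinv : invCorrLength (twoPointPlus d β) = liminf u atTop := rfl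
  -- upper bound `u M ≤ -log q`
  have hub : ∀ M, u M ≤ -Real.log q := by
    intro M
    have hlogq : Real.log q ≤ 0 := Real.log_nonpos hpos.le hq1
    simp only [hu]
    rw [abs_of_pos (haxis_pos M)]
    rcases Nat.eq_zero_or_pos M with hM | hM
    · subst hM
      simp only [CharP.cast_eq_zero, div_zero]
      linarith
    · have hM' : (0 : ℝ) < M := by exact_mod_cast hM
      have hlog := Real.log_le_log (pow_pos hpos M) (haxis M)
      rw [Real.log_pow] at hlog
      rw [div_le_iff₀ hM']
      linarith
  have hcobdd : IsCoboundedUnder (· ≥ ·) atTop u :=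
    isCoboundedUnder_ge_of_eventually_le atTop (Eventually.of_forall hub)
  -- lower bound `u M ≥ a (1 - (n+2)/M)` with `a = -log ψ/(n+2)`
  set a : ℝ := -Real.log ψ / ((n : ℝ) + 2) with ha
  have hlogψ : Real.log ψ < 0 := Real.log_neg hψpos hψ1
  have ha0 : 0 < a := div_pos (by linarith) hn2
  have hneg : -Real.log ψ = a * ((n : ℝ) + 2) := by rw [ha]; field_simp
  have hlow : ∀ M : ℕ, 1 ≤ M → a * (1 - ((n : ℝ) + 2) / M) ≤ u M := by
    intro M hM
    have hM' : (0 : ℝ) < M := by exact_mod_cast hM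
    set k := (M - 1) / (n + 2) with hk
    have hk1 : k * (n + 2) ≤ M - 1 := Nat.div_mul_le_self (M - 1) (n + 2)
    have hk2 : M - 1 < (n + 2) * (k + 1) := Nat.lt_mul_div_succ (M - 1) (by omega)
    have hMle : M ≤ (n + 2) * k + n + 2 := by
      have := hk2
      rw [Nat.mul_succ] at this
      omega
    have hkreal : (M : ℝ) ≤ ((n : ℝ) + 2) * k + n + 2 := by exact_mod_cast hMle
    have hS := twoPointPlus_le_bdryPsi_pow hβ n k (((M : ℤ)) • Pi.single (0 : Fin d) (1 : ℤ))
      (by rw [hnorm]; omega)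
    have hlogS : Real.log (twoPointPlus d β ((M : ℤ) • Pi.single (0 : Fin d) (1 : ℤ))) ≤
        k * Real.log ψ := by
      have := Real.log_le_log (haxis_pos M) hS
      rwa [Real.log_pow] at this
    simp only [hu]
    rw [abs_of_pos (haxis_pos M), le_div_iff₀ hM']
    calc a * (1 - ((n : ℝ) + 2) / M) * M = a * ((M : ℝ) - (n + 2)) := by field_simp
      _ ≤ a * (((n : ℝ) + 2) * k) := mul_le_mul_of_nonneg_left (by linarith) ha0.le
      _ = k * (a * ((n : ℝ) + 2)) := by ring
      _ = -(k * Real.log ψ) := by rw [← hneg]; ring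
      _ ≤ -Real.log (twoPointPlus d β ((M : ℤ) • Pi.single (0 : Fin d) (1 : ℤ))) := by linarith
  have hev : ∀ ε : ℝ, 0 < ε → ∀ᶠ M in atTop, a - ε ≤ u M := by
    intro ε hε
    obtain ⟨M₀, hM₀⟩ := exists_nat_gt (a * ((n : ℝ) + 2) / ε)
    filter_upwards [eventually_ge_atTop (max M₀ 1)] with M hM
    have hM1 : 1 ≤ M := le_of_max_le_right hM
    have hMM₀ : M₀ ≤ M := le_of_max_le_left hM
    have hM' : (0 : ℝ) < M := by exact_mod_cast hM1
    have h1 := hlow M hM1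
    have h2 : a * ((n : ℝ) + 2) / M ≤ ε := by
      rw [div_le_iff₀ hM']
      have h3 : a * ((n : ℝ) + 2) / ε < M₀ := hM₀
      rw [div_lt_iff₀ hε] at h3
      have hM₀M : (M₀ : ℝ) ≤ M := by exact_mod_cast hMM₀
      nlinarith
    calc a - ε ≤ a - a * ((n : ℝ) + 2) / M := by linarith
      _ = a * (1 - ((n : ℝ) + 2) / M) := by ring
      _ ≤ u M := h1
  have hlim : a ≤ liminf u atTop := by
    refine le_of_forall_pos_le_add fun ε hε => ?_
    have := le_liminf_of_le hcobdd (hev ε hε)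
    linarith
  -- conclusion: `L a ≤ 1`, i.e. `log ψ ≥ -(n+2)/L`
  have hfin : L * a ≤ 1 := by
    calc L * a ≤ L * liminf u atTop := mul_le_mul_of_nonneg_left hlim hL.le
      _ = L * invCorrLength (twoPointPlus d β) := by rw [hinv]
      _ ≤ 1 := hwin
  rw [← Real.le_log_iff_exp_le hψpos]
  have hkey : -Real.log ψ ≤ ((n : ℝ) + 2) / L := by
    rw [le_div_iff₀ hL, hneg]
    nlinarith
  rw [neg_div]
  linarith

/-- **The boundary functional is carried by the sphere**: `ψ_β(Λ_n) ≤ ∑_{y ∈ ∂Λ_n} 8dβ ⟨σ₀σ_y⟩⁺_β`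
(`β ≥ 0`): only the sites of `∂Λ_n` have neighbours outside `Λ_n`, at most `2d` of them, and
`⟨σ₀σ_y⟩⁺ ≤ ⟨σ₀σ_x⟩⁺` across each boundary bond (Messager–Miracle-Solé); the computation of
`sphereSum_twoPointPlus_criticalBeta_ge_one_of_peierls` at a general `β`
(Duminil-Copin 2019, proof of Thm. 4.8). [cite: DuminilCopin2019, proof of Thm. 4.8, §4.4] -/
theorem bdryPsi_box_le_sphereSum (hβ : 0 ≤ β) (n : ℕ) :
    bdryPsi d β (box d n) ≤ ∑ y ∈ sphere d n, 8 * d * β * twoPointPlus d β y := by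
  rw [bdryPsi_def]
  have hx_bound : ∀ x ∈ box d n,
      ∑ y ∈ ((zdGraph d).neighborFinset x).filter (· ∉ box d n),
        (twoPointPlus d β x + twoPointPlus d β y) ≤
      if Site.supNorm x = n then 4 * d * twoPointPlus d β x else 0 := by
    intro x hx
    split_ifs with hxn
    · calc ∑ y ∈ ((zdGraph d).neighborFinset x).filter (· ∉ box d n),
            (twoPointPlus d β x + twoPointPlus d β y)
          ≤ ∑ _y ∈ ((zdGraph d).neighborFinset x).filter (· ∉ box d n),
            2 * twoPointPlus d β x := by
            refine Finset.sum_le_sum fun y hy => ?_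
            obtain ⟨hy1, hy2⟩ := Finset.mem_filter.1 hy
            rw [SimpleGraph.mem_neighborFinset] at hy1
            have h := twoPointPlus_le_of_adj_of_not_mem_box hβ hx hy2 hy1
            linarith
        _ = #(((zdGraph d).neighborFinset x).filter (· ∉ box d n)) * (2 * twoPointPlus d β x) := by
            rw [Finset.sum_const, nsmul_eq_mul]
        _ ≤ (2 * d : ℝ) * (2 * twoPointPlus d β x) := by
            refine mul_le_mul_of_nonneg_right ?_
              (mul_nonneg (by norm_num) (twoPointPlus_nonneg_of_gks hβ x))
            have hnb : #((zdGraph d).neighborFinset x) ≤ 2 * d := by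
              classical
              have hsub : (zdGraph d).neighborFinset x ⊆
                  (univ : Finset (Fin d × Bool)).image fun p =>
                    if p.2 then x + Pi.single p.1 1 else x - Pi.single p.1 1 := by
                intro y hy
                rw [SimpleGraph.mem_neighborFinset] at hy
                obtain ⟨i, h | h⟩ := (zdGraph_adj_iff x y).1 hy
                · exact Finset.mem_image.2 ⟨(i, true), Finset.mem_univ _, by simp [h]⟩
                · exact Finset.mem_image.2 ⟨(i, false), Finset.mem_univ _, by simp [h]⟩
              refine (Finset.card_le_card hsub).trans (Finset.card_image_le.trans ?_)
              simp [mul_comm]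
            have h := (Finset.card_le_card (Finset.filter_subset (· ∉ box d n)
              ((zdGraph d).neighborFinset x))).trans hnb
            exact_mod_cast h
        _ = 4 * d * twoPointPlus d β x := by ring
    · have hlt : Site.supNorm x < n := lt_of_le_of_ne (mem_box_iff_supNorm_le.1 hx) hxn
      have hempty : ((zdGraph d).neighborFinset x).filter (· ∉ box d n) = ∅ := by
        refine Finset.eq_empty_of_forall_notMem fun y hy => ?_
        obtain ⟨hy1, hy2⟩ := Finset.mem_filter.1 hy
        rw [SimpleGraph.mem_neighborFinset] at hy1
        exact hy2 (mem_box_of_adj_of_supNorm_lt hlt hy1)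
      rw [hempty, Finset.sum_empty]
  calc 2 * β * ∑ x ∈ box d n, ∑ y ∈ ((zdGraph d).neighborFinset x).filter (· ∉ box d n),
        (twoPointPlus d β x + twoPointPlus d β y)
      ≤ 2 * β * ∑ x ∈ box d n,
        (if Site.supNorm x = n then 4 * d * twoPointPlus d β x else 0) :=
        mul_le_mul_of_nonneg_left (Finset.sum_le_sum hx_bound) (by positivity)
    _ = ∑ y ∈ sphere d n, 8 * d * β * twoPointPlus d β y := by
        rw [← Finset.sum_filter, Finset.mul_sum]
        refine Finset.sum_congr rfl fun y _ => ?_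
        ring

/-- `ψ_β(Λ_n) ≤ 8dβ |∂Λ_n|`, in particular `ψ_β(Λ_1) ≤ 8dβ 3^d` (`⟨σ₀σ_y⟩⁺ ≤ 1`). [folklore] -/
theorem bdryPsi_box_one_le (hβ : 0 ≤ β) : bdryPsi d β (box d 1) ≤ 8 * d * β * 3 ^ d := by
  refine (bdryPsi_box_le_sphereSum hβ 1).trans ?_
  calc ∑ y ∈ sphere d 1, 8 * d * β * twoPointPlus d β y ≤ ∑ _y ∈ sphere d 1, 8 * d * β * 1 := by
        refine Finset.sum_le_sum fun y _ => ?_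
        exact mul_le_mul_of_nonneg_left (twoPointPlus_le_one_of_nonneg hβ y) (by positivity)
    _ = #(sphere d 1) * (8 * d * β) := by rw [sum_const, nsmul_eq_mul, mul_one]
    _ ≤ #(box d 1) * (8 * d * β) := by
        gcongr
        exact sphere_subset_box d 1
    _ = 8 * d * β * 3 ^ d := by rw [card_box]; push_cast; ring

end PlusState

/-! ### Part 4. The window in `d = 4`: `ψ ≥ e^{-2}`, `β` bounded below, sphere sums -/

section Window

/-- In the critical window of `d = 4` — `β = β_c`, or `0 < β` with `L ξ(β)⁻¹ ≤ 1` — and for a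
non-degenerate two-point function (`⟨σ₀σ_{e₁}⟩⁺_β > 0`), `ψ_β(Λ_n) ≥ e^{-2}` for all `n ≤ L`,
`L ≥ 2` (at `β_c`: `ψ ≥ 1`, `one_le_bdryPsi_criticalBeta`, Duminil-Copin 2019, proof of Thm. 4.8;
below `β_c`: `exp_le_bdryPsi_of_invCorrLength`). [cite: DuminilCopin2019, proof of Thm. 4.8, §4.4] [cite: AizenmanDuminilCopinAnnals2021, arXiv:1912.07973 Cor. 5.8 (p. 19)] -/
theorem exp_neg_two_le_bdryPsi_of_window {β : ℝ} (hβ : 0 ≤ β) {L : ℕ} (hL : 2 ≤ L)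
    (hwin : β = criticalBeta 4 ∨ (0 < β ∧ (L : ℝ) * invCorrLength (twoPointPlus 4 β) ≤ 1))
    (hpos : 0 < twoPointPlus 4 β (Pi.single 0 1)) {n : ℕ} (hn : n ≤ L) :
    Real.exp (-2) ≤ bdryPsi 4 β (box 4 n) := by
  rcases hwin with hc | ⟨_, hw⟩
  · rw [hc]
    exact (Real.exp_le_one_iff.2 (by norm_num)).trans
      (one_le_bdryPsi_criticalBeta exists_spontaneousMagnetization_pos_holds (by norm_num) n)
  · have hL' : (0 : ℝ) < L := by exact_mod_cast (show 0 < L by omega)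
    refine le_trans ?_ (exp_le_bdryPsi_of_invCorrLength hβ hL' hw hpos n)
    rw [Real.exp_le_exp, neg_div, neg_le_neg_iff, div_le_iff₀ hL']
    have : (n : ℝ) ≤ L := by exact_mod_cast hn
    have : (2 : ℝ) ≤ L := by exact_mod_cast hL
    linarith

/-- In the window, `β ≥ e^{-2}/(32 · 81)`: `e^{-2} ≤ ψ_β(Λ_1) ≤ 8 · 4 · β · 3⁴`. [folklore] -/
theorem beta_ge_of_window {β : ℝ} (hβ : 0 ≤ β) {L : ℕ} (hL : 2 ≤ L)
    (hwin : β = criticalBeta 4 ∨ (0 < β ∧ (L : ℝ) * invCorrLength (twoPointPlus 4 β) ≤ 1))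
    (hpos : 0 < twoPointPlus 4 β (Pi.single 0 1)) :
    Real.exp (-2) / 2592 ≤ β := by
  have h1 := exp_neg_two_le_bdryPsi_of_window hβ hL hwin hpos (show 1 ≤ L by omega)
  have h2 := bdryPsi_box_one_le (d := 4) hβ
  rw [div_le_iff₀ (by norm_num)]
  have h3 : (8 * (4 : ℕ) * β * 3 ^ (4 : ℕ) : ℝ) = β * 2592 := by push_cast; ring
  linarith [h1.trans h2]

/-- In the window, the sphere sums are bounded below: `∑_{∂Λ_n} ⟨σ₀σ_y⟩⁺_β ≥ e^{-2}/(32 β_c)`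
for `1 ≤ n ≤ L` (from `e^{-2} ≤ ψ_β(Λ_n) ≤ 32 β ∑_{∂Λ_n} ⟨σ₀σ_y⟩⁺` and `β ≤ β_c`; the
`χ_N ≥ c N` input of Aizenman–Duminil-Copin 2021, proof of Thm 5.12). [cite: AizenmanDuminilCopinAnnals2021, arXiv:1912.07973 Theorem 5.12, proof, first display (p. 20)] -/
theorem sphereSum_ge_of_window {β : ℝ} (hβ : 0 < β) (hβc : β ≤ criticalBeta 4) {L : ℕ} (hL : 2 ≤ L)
    (hwin : β = criticalBeta 4 ∨ (0 < β ∧ (L : ℝ) * invCorrLength (twoPointPlus 4 β) ≤ 1))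
    (hpos : 0 < twoPointPlus 4 β (Pi.single 0 1)) {n : ℕ} (hn : n ≤ L) :
    Real.exp (-2) / (32 * criticalBeta 4) ≤ ∑ y ∈ sphere 4 n, twoPointPlus 4 β y := by
  have h1 := exp_neg_two_le_bdryPsi_of_window hβ.le hL hwin hpos hn
  have h2 := bdryPsi_box_le_sphereSum (d := 4) hβ.le n
  have hβc0 : 0 < criticalBeta 4 := hβ.trans_le hβc
  have hsum : ∑ y ∈ sphere 4 n, 8 * (4 : ℕ) * β * twoPointPlus 4 β y =
      32 * β * ∑ y ∈ sphere 4 n, twoPointPlus 4 β y := by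
    rw [Finset.mul_sum]
    refine Finset.sum_congr rfl fun y _ => ?_
    push_cast
    ring
  rw [hsum] at h2
  have h0 : 0 ≤ ∑ y ∈ sphere 4 n, twoPointPlus 4 β y :=
    Finset.sum_nonneg fun y _ => twoPointPlus_nonneg_of_gks hβ.le y
  rw [div_le_iff₀ (mul_pos (by norm_num) hβc0)]
  calc Real.exp (-2) ≤ 32 * β * ∑ y ∈ sphere 4 n, twoPointPlus 4 β y := h1.trans h2
    _ ≤ 32 * criticalBeta 4 * ∑ y ∈ sphere 4 n, twoPointPlus 4 β y :=
        mul_le_mul_of_nonneg_right (mul_le_mul_of_nonneg_left hβc (by norm_num)) h0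
    _ = (∑ y ∈ sphere 4 n, twoPointPlus 4 β y) * (32 * criticalBeta 4) := by ring

/-- **Degenerate two-point functions.** If `⟨σ₀σ_{e₁}⟩⁺_β = 0` (`β ≥ 0`, `d ≥ 1`) then
`⟨σ₀σ_y⟩⁺_β = 0` for all `y ≠ 0` (Messager–Miracle-Solé along the axis and eq. (4.10):
`⟨σ₀σ_y⟩⁺ ≤ ⟨σ₀σ_{‖y‖e₁}⟩⁺ ≤ ⟨σ₀σ_{e₁}⟩⁺`). [cite: DuminilCopin2019, Exercise 37 (3)–(4), eq. (4.10), §4.3] -/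
theorem twoPointPlus_eq_zero_of_axis_eq_zero {d : ℕ} {β : ℝ} (hβ : 0 ≤ β) (hd : 1 ≤ d)
    (h0 : twoPointPlus d β (Pi.single ⟨0, hd⟩ 1) = 0) {y : Site d} (hy : y ≠ 0) :
    twoPointPlus d β y = 0 := by
  have hMMS : ∀ {β : ℝ}, messager_miracleSole (d := d) (β := β) := fun {β} =>
    messager_miracleSole_holds (d := d) (β := β)
  set m := Site.supNorm y with hm
  have hm1 : 1 ≤ m := Nat.one_le_iff_ne_zero.2 fun h => hy (Site.supNorm_eq_zero_iff.1 h)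
  have h1 := twoPointPlus_le_axis_of_mem_sphere hMMS twoPointPlus_reflection_invariant_holds
    twoPointPlus_perm_invariant_holds hβ hd (self_mem_sphere y)
  have h2 := twoPointPlus_add_single_le hMMS hβ (Pi.single (⟨0, hd⟩ : Fin d) (1 : ℤ)) ⟨0, hd⟩
    (by simp) (m - 1)
  have heq : (Pi.single (⟨0, hd⟩ : Fin d) (1 : ℤ) : Site d) + Pi.single (⟨0, hd⟩ : Fin d) ((m - 1 : ℕ) : ℤ) =
      Pi.single (⟨0, hd⟩ : Fin d) (m : ℤ) := by
    rw [← Pi.single_add]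
    congr 1
    rw [Nat.cast_sub hm1]
    push_cast
    ring
  rw [heq] at h2
  rw [← hm] at h1
  have h3 : twoPointPlus d β y ≤ 0 := h1.trans (h2.trans h0.le)
  exact le_antisymm h3 (twoPointPlus_nonneg_of_gks hβ y)

end Window


/-! ### Part 5. Assembly: Lemma 6.3 from Theorem 5.6 -/

section Assembly

/-- **The two-point function of `μ ∈ 𝒢(β, 0)` in `d = 4`, `0 ≤ β ≤ β_c`, is the plus-state
two-point function**: `⟨σ₀σ_x⟩_μ = ⟨σ₀σ_x⟩⁺_β` (uniqueness of the Gibbs measure below `β_c` and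
at `β_c` for `d ≥ 3` — `hasUniqueGibbsMeasure_of_lt_criticalBeta_holds`,
`hasUniqueGibbsMeasure_criticalBeta_holds` — identifies `μ` with the free state, and
`⟨σ₀σ_x⟩^∅_β = ⟨σ₀σ_x⟩⁺_β` when `m*(β) = 0`, Lebowitz–Martin-Löf). [cite: FriedliVelenik2017, Thm. 3.28 and Exercise 3.16] [cite: LebowitzMartinlof1972, Theorem] -/
theorem twoPoint_eq_twoPointPlus_of_isingGibbsMeasure {β : ℝ} (hβ : 0 ≤ β)
    (hβc : β ≤ criticalBeta 4) {μ : Measure (SpinConfig (Site 4))}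
    (hμ : μ ∈ isingGibbsMeasures 4 β 0) : twoPoint μ spinAt 0 = twoPointPlus 4 β := by
  obtain ⟨_, htwo⟩ := isingGibbsMeasure_twoPoint_of_facts
    hasUniqueGibbsMeasure_of_lt_criticalBeta_holds hasUniqueGibbsMeasure_criticalBeta_holds
    (fun d => exists_freeMeasure_holds d 0) (by norm_num) hβ hβc hμ
  have hm : spontaneousMagnetization 4 β = 0 := by
    rcases hβc.lt_or_eq with hlt | heq
    · exact le_antisymm
        (not_lt.1 fun hpos => not_le.2 hlt (csInf_le ⟨0, fun _ hb => hb.1⟩ ⟨hβ, hpos⟩))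
        (spontaneousMagnetization_nonneg_holds (d := 4) hβ)
    · rw [heq]
      exact spontaneousMagnetization_criticalBeta_eq_zero_holds (d := 4) (by norm_num)
  funext x
  rw [show twoPoint μ spinAt 0 x = ∫ ω, spinAt 0 ω * spinAt x ω ∂μ from rfl, htwo 0 x, sub_zero,
    twoPointFree_eq_twoPointPlus_of_spontaneousMagnetization_eq_zero hβ hm]

/-- **Aizenman–Duminil-Copin 2021, Lemma 6.3, from Theorem 5.6.** The named fact
`aizenmanDuminilCopin_bubbleDiagram_growth` (growth of the bubble diagram in `d = 4`: there is
`C > 0` with `B_L(β) ≤ (1 + C (1 + log(L/ℓ))/log ℓ) B_ℓ(β)` for integer scales `2 ≤ ℓ ≤ L` in the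
window `L ≤ ξ(β)`, `0 ≤ β ≤ β_c`, every `μ ∈ 𝒢(β, 0)`) follows from the sliding-scale infrared
bound `aizenmanDuminilCopin_slidingScaleInfraredBound` (ADC Thm 5.6); the Messager–Miracle-Solé
comparison, the abundance of P4-regular scales, the lower bound on the two-point function in the
window, uniqueness of the Gibbs state up to `β_c` and the dyadic bookkeeping of the printed proof
are theorems (this file and the tree). [cite: AizenmanDuminilCopinAnnals2021, arXiv:1912.07973 Lemma 6.3 and its proof (p. 21), with Theorem 5.6 (p. 18) and Theorem 5.12 (p. 20)] -/
theorem aizenmanDuminilCopin_bubbleDiagram_growth_of_slidingScaleInfraredBound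
    (hT : aizenmanDuminilCopin_slidingScaleInfraredBound) :
    aizenmanDuminilCopin_bubbleDiagram_growth := by
  unfold aizenmanDuminilCopin_bubbleDiagram_growth
  obtain ⟨C_T, hC_T, hT4⟩ := hT (d := 4) (by norm_num)
  set β₀ : ℝ := Real.exp (-2) / 2592 with hβ₀
  have hβ₀pos : 0 < β₀ := by positivity
  set K : ℝ := max (C_T / β₀) 1 with hK
  have hK1 : 1 ≤ K := le_max_right _ _
  have hβc0 : 0 < criticalBeta 4 := criticalBeta_pos_holds (d := 4) (by norm_num)
  set θ : ℝ := min (Real.exp (-2) / (32 * criticalBeta 4)) 1 with hθ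
  have hθpos : 0 < θ := lt_min (div_pos (Real.exp_pos _) (mul_pos (by norm_num) hβc0)) one_pos
  have hθ1 : θ ≤ 1 := min_le_right _ _
  obtain ⟨C, hC, hmain⟩ := bubbleDiagram_growth_abstract K θ hK1 hθpos hθ1
  refine ⟨C, hC, ?_⟩
  intro β ℓ L hβ0 hβc hℓ2 hℓL hwin μ hμ
  have hβpos : 0 < β := by
    rcases hwin with h | h
    · rw [h]; exact hβc0
    · exact h.1
  have hL2 : 2 ≤ L := hℓ2.trans hℓL
  have hS := twoPoint_eq_twoPointPlus_of_isingGibbsMeasure hβ0 hβc hμ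
  rw [hS]
  have h0 : ∀ x, 0 ≤ twoPointPlus 4 β x := twoPointPlus_nonneg_of_gks hβ0
  have h1 : ∀ x, twoPointPlus 4 β x ≤ 1 := twoPointPlus_le_one_of_nonneg hβ0
  have hS0 : twoPointPlus 4 β 0 = 1 := twoPointPlus_zero 4 β
  by_cases hdeg : twoPointPlus 4 β (Pi.single 0 1) = 0
  · -- degenerate two-point function: `B ≡ 1`
    have hB : ∀ t : ℕ, bubbleDiagram (twoPointPlus 4 β) (t : ℕ) = 1 := by
      intro t
      rw [bubbleDiagram_natCast, ← Finset.add_sum_erase _ _ (zero_mem_box 4 t), hS0, one_pow,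
        Finset.sum_eq_zero fun x hx => ?_, add_zero]
      rw [twoPointPlus_eq_zero_of_axis_eq_zero hβ0 (by norm_num : 1 ≤ 4) hdeg
        (Finset.ne_of_mem_erase hx)]
      norm_num
    rw [hB, hB, mul_one]
    have hℓreal : (2 : ℝ) ≤ ℓ := by exact_mod_cast hℓ2
    have hlogℓ : 0 < Real.log ℓ := Real.log_pos (by linarith)
    have hLℓ : (1 : ℝ) ≤ (L : ℝ) / ℓ := by
      rw [le_div_iff₀ (by positivity), one_mul]; exact_mod_cast hℓL
    have hlogLℓ : 0 ≤ Real.log ((L : ℝ) / ℓ) := Real.log_nonneg hLℓ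
    have : 0 ≤ C * (1 + Real.log ((L : ℝ) / ℓ)) / Real.log ℓ := by positivity
    linarith
  · have hpos : 0 < twoPointPlus 4 β (Pi.single 0 1) := lt_of_le_of_ne (h0 _) (Ne.symm hdeg)
    have hMMS : ∀ x y : Site 4, 4 * Site.supNorm x ≤ Site.supNorm y →
        twoPointPlus 4 β y ≤ twoPointPlus 4 β x :=
      fun x y h => twoPointPlus_le_of_mul_supNorm_le hβ0 h
    have hββ₀ : β₀ ≤ β := beta_ge_of_window hβ0 hL2 hwin hpos
    have hLB : ∀ n : ℕ, 1 ≤ n → n ≤ L → θ ≤ ∑ y ∈ sphere 4 n, twoPointPlus 4 β y :=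
      fun n _ hn => (min_le_left _ _).trans (sphereSum_ge_of_window hβpos hβc hL2 hwin hpos hn)
    have hTK : ∀ n m : ℕ, 1 ≤ n → n ≤ m →
        boxSusceptibility (twoPointPlus 4 β) (m : ℕ) / (m : ℝ) ^ 2 ≤ K * (boxSusceptibility (twoPointPlus 4 β) (n : ℕ) / (n : ℝ) ^ 2) := by
      intro n m hn hnm
      have h := hT4 β n m hβpos hβc (by exact_mod_cast hn) (by exact_mod_cast hnm) μ hμ
      rw [hS] at h
      refine h.trans (mul_le_mul_of_nonneg_right ?_ (div_nonneg (boxSusceptibility_nonneg h0 _) (sq_nonneg _)))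
      calc C_T / β ≤ C_T / β₀ := div_le_div_of_nonneg_left hC_T.le hβ₀pos hββ₀
        _ ≤ K := le_max_left _ _
    exact hmain _ h0 h1 hS0 hMMS hTK ℓ L hℓ2 hℓL hLB

end Assembly

end Literature.Probability.LatticeModels
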